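import Mathlib
import Literature.Computability.Complexity.BoolEncodings
import Literature.Computability.Complexity.Oracle
import Literature.Computability.Complexity.TimeBounds
import Literature.Computability.Complexity.TimeBoundsProofs
import Literature.Computability.Complexity.SpaceLoop
import Literature.Computability.Complexity.TimeToSpace
import Literature.Computability.MetaComplexity.ChenJinSanthanamWilliams2022.PNPStreamingRefuterMagnification
import HarnessLib

/-!
# Chen–Jin–Santhanam–Williams 2022 — audit note on D14: a step budget measured on `|x|` forces long step outputs
# (magnification-gap census, row R65; GAPS W-A11d-1)

An AUDIT CERTIFICATE for the census definition D14 (`StepExpTime`, `EXPRel`, `EXPNP` in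
`PNPStreamingRefuterMagnification.lean`). No new cited fact is minted; everything below is
PROVED.

**The point.** `StepExpTime M eb k` asks ONE `TM2ComputableAux Bool Bool` to compute the step
function on EVERY step-input `(x, answers)` within `2 ^ (|x| ^ k + k)` steps — a budget that does
not see `answers`. The tree's halting convention (`TM2ComputableAux.OutputsWithin` targets
Mathlib's `Turing.haltList`: at halt every stack other than the output stack is empty; a TM2 step
pops at most `TimeToSpace.machinePopBound` symbols, `TimeToSpace.stkLen_le_of_iterate`) gives the
general inequality `input_length_le_of_outputsWithin`:
`|input| ≤ |output| + machinePopBound · time`.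
Since the encoded step-input `boolPair x (listBool.encode answers)` is unboundedly long for fixed
`x` (a list is no longer than its `listBool` code), a machine witnessing `StepExpTime` must produce, on long
transcripts, step OUTPUTS that are themselves long (`StepExpTime.input_length_le`); in particular
NO oracle algorithm whose step output length is bounded by a function of `x` alone satisfies
`StepExpTime` (`not_stepExpTime_of_output_le`) — e.g. the zero-query machines `OracleAlg.ofFun g`,
the canonical witnesses of `P ⊆ P^O` in `Complexity/OracleProofs.lean`, are excluded for EVERY `g`
and `k` (`not_stepExpTime_ofFun`).

**What this does and does not say about `EXPRel`.** It does NOT show `EXPRel O = ∅`: a machine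
with input stack = output stack may, on over-long transcripts (which never arise in its own runs),
halt after replacing the top symbol by the `inl` tag, thereby emitting the tail of its transcript as
a junk QUERY — a legal output because `encodingList Bool` is the identity encoding and
`Encoding.sumBool` prefixes one tag bit; reading `x` and the unary length prefix of
`listBool.encode answers` first lets it decide cheaply whether to do this or to re-simulate. So the
module docstring's claim "`EXPRel (ofLanguage SAT)` contains textbook `EXP^NP`" is plausibly TRUE,
but NOT by the plain re-simulation argument stated there (the re-simulating machine reads its whole
transcript and violates the budget on long ones, exactly as `ofFun` does); it needs the junk-query
device, and it is unproved in the tree (referee F40). The containment is the load-bearing step of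
the row's F-direction (print's `EXP^NP ≠ BPP` implies the typed `EXPNP ≠ BPP` only via
`EXP^NP ⊆ EXPNP`). A robust alternative typing measures the step time polynomially in the
STEP-INPUT length (the tree's `OracleAlg.IsPolyTime`, as in `PRel`) and puts the exponential into
the round/query budget only; see GAPS W-A11d-1 for the comparison. [cite: ChenEtAl2022, Thm. 1.3 and §3.1]
[cite: AroraBarak2009, §1.2 (halting convention of multi-tape machines)]
-/

namespace Literature.Computability.MetaComplexity.ChenJinSanthanamWilliams2022

open _root_.Computability Turing Literature.Computability.Complexity

/-- **Input must be consumed.** If a bundled TM2 machine halts on input `l` with output `l'`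
within `t` steps, then `|l| ≤ |l'| + P · t` with `P = TimeToSpace.machinePopBound`: the halting
configuration `haltList` has every stack but the output stack empty, and one step pops at most `P`
symbols (`TimeToSpace.stkLen_le_of_iterate`, read between `initList` and `haltList`). This is the
inequality announced in the docstring of `TM2ComputableAux.OutputsWithin` ("forces
`m ≳ l.length`"). [folklore] [cite: AroraBarak2009, §1.2] -/
theorem input_length_le_of_outputsWithin {Γ₀ Γ₁ : Type} (T : TM2ComputableAux Γ₀ Γ₁)
    {l : List Γ₀} {l' : List Γ₁} {t : ℕ} (h : T.OutputsWithin l l' t) :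
    l.length ≤ l'.length + TimeToSpace.machinePopBound T.tm * t := by
  obtain ⟨⟨⟨n, hn⟩, hnt⟩⟩ := h
  have H := TimeToSpace.stkLen_le_of_iterate T.tm hn
  rw [SpaceLoop.stkLen_initList, TimeToSpace.stkLen_haltList, List.length_map,
    List.length_map] at H
  change n ≤ t at hnt
  exact H.trans (Nat.add_le_add_left (Nat.mul_le_mul_left _ hnt) _)

/-- The unary code of `n` has length `n` (private copy, tree convention; Mathlib's
`unary_decode_encode_nat`). [folklore] -/
private theorem length_unaryEncodeNat (n : ℕ) : (unaryEncodeNat n).length = n :=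
  unary_decode_encode_nat n

/-- A list is no longer than its `listBool` encoding (whose unary length prefix alone, doubled by
`boolPair`, has `2 · |l|` symbols). Private: the same fact exists as
`Literature.Algebra.EuclideanLattices.Khot.length_le_length_listBool`, which this topic may not
import. [folklore] -/
private theorem length_le_listBool_encode {α : Type} (e : Encoding α Bool) (l : List α) :
    l.length ≤ (e.listBool.encode l).length := by
  change l.length ≤ (boolPair (unaryEncodeNat l.length) _).length
  rw [length_boolPair, length_unaryEncodeNat]
  omega

/-- **Necessary condition for `StepExpTime`.** A machine computing the step function of `M`
within `2 ^ (|x| ^ k + k)` steps on every step-input satisfies, for some constant `P`,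
`|boolPair x (listBool.encode answers)| ≤ |encode (M.step x answers)| + P · 2 ^ (|x| ^ k + k)` for
ALL `(x, answers)`: on long transcripts the step OUTPUT must be long (from
`input_length_le_of_outputsWithin`). [folklore] -/
theorem StepExpTime.input_length_le {β : Type} {M : OracleAlg β} {eb : Encoding β Bool} {k : ℕ}
    (h : StepExpTime M eb k) :
    ∃ P : ℕ, ∀ (x : List Bool) (answers : List (List Bool)),
      (boolPair x ((encodingList Bool).listBool.encode answers)).length ≤
        (((encodingList Bool).sumBool eb).encode (M.step x answers)).length +
          P * 2 ^ (x.length ^ k + k) := by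
  obtain ⟨T, hT⟩ := h
  exact ⟨TimeToSpace.machinePopBound T.tm, fun x answers =>
    input_length_le_of_outputsWithin T (hT (x, answers))⟩

/-- **No machine with `x`-bounded step outputs satisfies `StepExpTime`.** If the encoded step
output of `M` on `(x, answers)` has length at most `B x` — independent of `answers` — then
`StepExpTime M eb k` fails for every `k`: take `x = []` and `B [] + P · 2 ^ (0 ^ k + k) + 1` empty
answers. [folklore] -/
theorem not_stepExpTime_of_output_le {β : Type} (M : OracleAlg β) (eb : Encoding β Bool) (k : ℕ)
    (B : List Bool → ℕ)
    (hB : ∀ (x : List Bool) (answers : List (List Bool)),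
      (((encodingList Bool).sumBool eb).encode (M.step x answers)).length ≤ B x) :
    ¬ StepExpTime M eb k := by
  intro h
  obtain ⟨P, hP⟩ := h.input_length_le
  set c : ℕ := P * 2 ^ (([] : List Bool).length ^ k + k) with hc
  set m : ℕ := B [] + c + 1 with hm
  have h1 := hP [] (List.replicate m ([] : List Bool))
  have h2 := hB [] (List.replicate m ([] : List Bool))
  have h3 := length_le_listBool_encode (encodingList Bool) (List.replicate m ([] : List Bool))
  rw [length_boolPair] at h1
  rw [List.length_replicate] at h3
  rw [← hc] at h1
  simp only [List.length_nil, Nat.mul_zero, Nat.zero_add] at h1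
  omega

/-- **The zero-query machines are excluded.** `OracleAlg.ofFun g` (answer `g x` at once, no
queries — the witness of `P ⊆ P^O` in `Complexity/OracleProofs.lean`) never satisfies
`StepExpTime`, for ANY `g : List Bool → Bool` and any exponent `k`: its step output
`true :: encodingBoolBool.encode (g x)` is short while its step-inputs are arbitrarily long. Hence
the natural embedding of time classes into `EXPRel O` fails at the machine level; membership in
`EXPRel O` has to go through machines that pad over-long transcripts with junk queries (module
docstring). [folklore] -/
theorem not_stepExpTime_ofFun (g : List Bool → Bool) (k : ℕ) :
    ¬ StepExpTime (OracleAlg.ofFun g) encodingBoolBool k :=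
  not_stepExpTime_of_output_le _ _ k
    (fun x => (((encodingList Bool).sumBool encodingBoolBool).encode
      (Sum.inr (g x) : List Bool ⊕ Bool)).length)
    (fun _ _ => le_rfl)


end Literature.Computability.MetaComplexity.ChenJinSanthanamWilliams2022
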